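import Literature.AnabelianGeometry.EtaleTheta.Discharge.Sec4BaseEquivOfTemperoids
import Literature.AnabelianGeometry.SemiGraphs.ConnectedPartEquivExtension

/-!
# [SemiAnbd] Prop. 3.2 for a (self-)equivalence of the CONNECTED PART `B^temp(Π₁)⁰ ≌ B^temp(Π₂)⁰`: it is `B^temp(φ)` for an
# ISOMORPHISM `φ` of tempered groups — the base category `D = B^temp(Π^tp_X)⁰` of [EtTh] §3–§5

S. Mochizuki, *Semi-graphs of anabelioids*, Publ. RIMS **42** (2006) [MochizukiSemiAnbd2006], Prop. 3.2 p.35, Rmk. 3.1.5 p.34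
(`B^temp(Π)⁰ ⊆ B^temp(Π)`, the temperoid recovered from its connected part); S. Mochizuki, *The étale theta function …*, Publ. RIMS
**45** (2009) [MochizukiEtTh2009], Def. 3.6 (ii) p.302 (PDF p.76) (`D` «a connected, totally epimorphic category», in §5
`D = B^temp(Π^tp_X)⁰`), Thm. 4.4 (i) proof p.321 (PDF p.95) ll.5–6 and Thm. 5.6 proof p.328 (PDF p.102) l.−2 («hence [cf. [SemiAnbd],
Proposition 3.2] an outer automorphism of the tempered fundamental group»).

abc-iut cell, layer L2 (seat abc-iut-w5-d013 gen 4; the functor-level form asked for by abc-iut-L2-d4 g4 as «FILE A» of the Thm 5.7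
residual-B sizing, STATUS 2026-08-26T08:43:57Z).  PROOF-ONLY, one step: gen 3's `BTemp.exists_equivalence_extension` (every
equivalence of connected parts extends to the temperoids, `ConnectedPartEquivExtension`) followed by gen 3's
`BTemp.exists_res_iso_of_equivalence` ([SemiAnbd] Prop. 3.2 for an equivalence of temperoids, `Sec4BaseEquivOfTemperoids`).
* `BTemp.exists_res_iso_of_connectedPart_equivalence` — for tempered, second-countable `Π₁`, `Π₂` and
  `E⁰ : B^temp(Π₁)⁰ ≌ B^temp(Π₂)⁰`: mutually inverse continuous homomorphisms `φ : Π₂ → Π₁`, `ψ : Π₁ → Π₂` with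
  `E⁰ ⋙ ι₂ ≅ ι₁ ⋙ B^temp(φ)` (`ιᵢ` the inclusions of the connected parts);
* `BTemp.exists_continuousMulEquiv_res_iso_of_connectedPart_equivalence` — the same with `φ` packaged as an isomorphism of
  topological groups `Φ : Π₂ ≃ₜ* Π₁` (`Φ = φ` pointwise).
The object-level shadow on Galois objects (with the inner-automorphism ambiguity made explicit) is gen 3's
`GaloisObjects.exists_conj_of_induced_connectedPart` (`Sec5GaloisShadowOfConnectedTemperoid`).  Nothing here bears on [IUTchIII]
Cor. 3.12 (refereed pre-IUT material).
-/

noncomputable section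

open CategoryTheory Topology

namespace Literature.AnabelianGeometry.SemiGraphs

universe u

namespace BTemp

open Literature.AlgebraicGeometry.Frobenioids

variable {G₁ : Type u} [Group G₁] [TopologicalSpace G₁] [IsTopologicalGroup G₁] [SecondCountableTopology G₁]
  {G₂ : Type u} [Group G₂] [TopologicalSpace G₂] [IsTopologicalGroup G₂] [SecondCountableTopology G₂]

/-- **[SemiAnbd] Prop. 3.2 for an equivalence of connected parts**: for tempered, second-countable `Π₁`, `Π₂` and an equivalence
`E⁰ : B^temp(Π₁)⁰ ≌ B^temp(Π₂)⁰` there are mutually inverse continuous homomorphisms `φ : Π₂ → Π₁`, `ψ : Π₁ → Π₂` with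
`E⁰ ⋙ ι₂ ≅ ι₁ ⋙ B^temp(φ)`. [cite: MochizukiSemiAnbd2006, Prop 3.2 p.35] -/
theorem exists_res_iso_of_connectedPart_equivalence (h₁ : IsTempered G₁) (h₂ : IsTempered G₂)
    (E₀ : ConnectedPart (BTemp G₁) ≌ ConnectedPart (BTemp G₂)) :
    ∃ (φ : G₂ →ₜ* G₁) (ψ : G₁ →ₜ* G₂), (∀ x, ψ (φ x) = x) ∧ (∀ y, φ (ψ y) = y) ∧
      Nonempty (E₀.functor ⋙ (connectedObjects (BTemp G₂)).ι ≅ (connectedObjects (BTemp G₁)).ι ⋙ BTemp.res φ) := by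
  obtain ⟨E, ⟨ηE⟩⟩ := BTemp.exists_equivalence_extension E₀
  obtain ⟨φ, ψ, hψφ, hφψ, ⟨iφ⟩, -⟩ := BTemp.exists_res_iso_of_equivalence h₁ h₂ E
  exact ⟨φ, ψ, hψφ, hφψ, ⟨ηE ≪≫ Functor.isoWhiskerLeft (connectedObjects (BTemp G₁)).ι iφ⟩⟩

/-- **The same, with `φ` an isomorphism of topological groups** `Φ : Π₂ ≃ₜ* Π₁` (`Φ x = φ x`): every (self-)equivalence of
`B^temp(Π)⁰` «is» `B^temp(Φ)` — print's «outer automorphism of the tempered fundamental group» induced by `Ψ^bs : D ⥲ D`.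
[cite: MochizukiSemiAnbd2006, Prop 3.2 p.35] -/
theorem exists_continuousMulEquiv_res_iso_of_connectedPart_equivalence (h₁ : IsTempered G₁) (h₂ : IsTempered G₂)
    (E₀ : ConnectedPart (BTemp G₁) ≌ ConnectedPart (BTemp G₂)) :
    ∃ (Φ : G₂ ≃ₜ* G₁) (φ : G₂ →ₜ* G₁), (∀ x, Φ x = φ x) ∧
      Nonempty (E₀.functor ⋙ (connectedObjects (BTemp G₂)).ι ≅ (connectedObjects (BTemp G₁)).ι ⋙ BTemp.res φ) := by
  obtain ⟨φ, ψ, hψφ, hφψ, hiso⟩ := exists_res_iso_of_connectedPart_equivalence h₁ h₂ E₀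
  let Φ : G₂ ≃ₜ* G₁ :=
    { toFun := φ, invFun := ψ, left_inv := hψφ, right_inv := hφψ, map_mul' := fun x y => map_mul φ x y
      continuous_toFun := φ.continuous, continuous_invFun := ψ.continuous }
  exact ⟨Φ, φ, fun _ => rfl, hiso⟩

end BTemp

end Literature.AnabelianGeometry.SemiGraphs

end
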